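import Summits.ResolutionOfSingularities.ResolutionOfSingularities.Theorems.EquisingularLiftEquisingularLiftNatNoseResidueUnfoldNu
import HarnessLib

/-!
# [OURS · L1 W4.5(b) · EL♮(3) · nose residue, brick N-1 (a)] The ZERO-ROUND CERTIFICATE SCHEMA for the ν1 nose predicate
# `NoseHypUnobsBTriplePrime`: one unobstructed regular curve, one blow-up, empty round phase

Cell `res-hironaka`, LADDER-RESOLUTION rung L (D-0089), slot W4.5(b), crux chain w45b: child crux **EL♮(3)** =
stmt-ResolutionOfSingularities-20148, parent EL♮ = stmt-…-20038; registered nose residue of record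
`stub_elnat_three_nonisolated_nonUnobsNonPointsFirstNoseBTriplePrime` (38th registration, CHILD v44r), whose hypothesis
`¬ NoseHypUnobsBTriplePrime k n H ι` ((H-ν1), …NatResidueHypDefs5 ✓ p648428; rung (R-ν1) ✓ p651025) entered at the 37th registration.
WIDTH seat res-L1-w45b-nose-w1 g2 (D-0157 DOOR 1), desk booking **N-1** «Whitney cubic ∈ ν1» (STATUS 2026-08-28T18:04:04Z), piece (a) of three
((b) the double-line instance of `DirStepUnobs` in `ℙ³`, (c) the assembly). `--supports stmt-ResolutionOfSingularities-20148 --as helper`.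
OURS; NOT a statement of H. Hironaka's 2017 manuscript (nothing of [Hironaka2017] is asserted); AI-written, AI review weaker than expert review.
DEF-FREE; pure logic over tree definitions; no `sorry`; standard axioms. EL♮(3) is NOT proved here; resolution in positive characteristic is NOT
proved here (dimension 3 is Cossart–Piltant 2008/2009 in print).

WHAT. `noseHypUnobsBTriplePrime_of_oneBlowup` — the ν1 twin of res-L1-w45b-nose-w3's `reachNoseTowerBTriplePrime_of_oneBlowup` (✓ p642717):
a closed `Z ⊆ ι(H) ⊄ Z`, infinite, with one-dimensional local rings at the closed points of `Z̃ = Z_red`, `Z̃` REGULAR, UNOBSTRUCTED in `ℙⁿ_k`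
(`DirStepUnobs ℙⁿ univ _ Z hZ`, i.e. `Ȟ¹(Z̃, 𝒩_{Z̃/ℙⁿ}) = 0` in the tree's Čech currency — produced per specimen by ✓ p654480 / ✓ p655133), and ONE
blow-up `υ` of `𝓘⟨Z⟩` whose reduced strict transform `(closure υ⁻¹(ι(H) ∖ Z))_red` is regular, give `NoseHypUnobsBTriplePrime k n H ι` — the B‴
round phase is EMPTY (`F' = F₂`, `γ' = 𝟙`, `T' = closure υ⁻¹(ι(H) ∖ Z)`, `E' = υ⁻¹ Z`, `Es' = Ns' = []`, `K' = ∅`); the clause «`ℙⁿ_k` regular along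
`Z̃`» is free at the initial stage (res-L1-w45b-nose-w4's `noseHypUnobsBTriplePrime_iff_of_ambient`, ✓ p649219). Every «one regular
unobstructed nose, one blow-up resolves» specimen is certified in ν1 by discharging these concrete clauses.

References (index only): R. Hartshorne, *Algebraic Geometry* (1977), II §7 (blow-ups), III Ex. 4.5 (Čech classes) [cite: Hartshorne1977].
-/

set_option linter.dupNamespace false -- mandated namespace `Summit.<Summit>.<Problem>` of this single-conjunct summit

noncomputable section

open CategoryTheory CategoryTheory.Limits AlgebraicGeometry TopologicalSpace
open Literature.AlgebraicGeometry.Resolution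
open AlgebraicGeometry.Scheme.IdealSheafData

namespace Summit.ResolutionOfSingularities.ResolutionOfSingularities.Cruxes.EquisingularLiftNat.Sections

/-- **ZERO-ROUND CERTIFICATE SCHEMA for `NoseHypUnobsBTriplePrime`** (any field `k`, any `n`): a closed `Z ⊆ ι(H)` with `ι(H) ⊄ Z`, `Z`
infinite, one-dimensional local rings at the closed points of `Z̃`, `Z̃` regular, `DirStepUnobs ℙⁿ univ _ Z hZ`, and ONE blow-up `υ` of `𝓘⟨Z⟩` whose
reduced strict transform `(closure υ⁻¹(ι(H) ∖ Z))_red` is regular ⟹ `NoseHypUnobsBTriplePrime k n H ι` (empty round phase; the ambient clause by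
`noseHypUnobsBTriplePrime_iff_of_ambient`). [OURS · L1 W4.5b · EL♮(3) · N-1 (a) · pure logic; NOT a statement of the manuscript] -/
theorem noseHypUnobsBTriplePrime_of_oneBlowup (k : Type) [Field k] (n : ℕ) (H : Scheme.{0})
    (ι : H ⟶ (Literature.AlgebraicGeometry.Motives.projectiveSpace n k).left)
    (Z : Set (Literature.AlgebraicGeometry.Motives.projectiveSpace n k).left) (hZ : IsClosed Z)
    (hZreg : ∀ x : redSub (Literature.AlgebraicGeometry.Motives.projectiveSpace n k).left Z hZ,
      IsRegularLocalRing ((redSub (Literature.AlgebraicGeometry.Motives.projectiveSpace n k).left Z hZ).presheaf.stalk x))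
    (hunobs : DirStepUnobs (Literature.AlgebraicGeometry.Motives.projectiveSpace n k).left Set.univ isClosed_univ Z hZ)
    (hsub : Z ⊆ Set.range ι) (hnot : ¬ (Set.range ι ⊆ Z)) (hinf : Z.Infinite)
    (hcurve : ∀ z : ↥(redSub (Literature.AlgebraicGeometry.Motives.projectiveSpace n k).left Z hZ),
      IsClosed ({z} : Set ↥(redSub (Literature.AlgebraicGeometry.Motives.projectiveSpace n k).left Z hZ)) →
        ringKrullDim ((redSub (Literature.AlgebraicGeometry.Motives.projectiveSpace n k).left Z hZ).presheaf.stalk z) =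
          ((1 : ℕ) : WithBot ℕ∞))
    (F₂ : Scheme.{0}) (υ : F₂ ⟶ (Literature.AlgebraicGeometry.Motives.projectiveSpace n k).left)
    (hυ : IsBlowup υ (vanishingIdeal (⟨Z, hZ⟩ : Closeds (Literature.AlgebraicGeometry.Motives.projectiveSpace n k).left)))
    (hreg : Scheme.IsRegular (redSub F₂ (closure (υ ⁻¹' (Set.range ι \ Z))) isClosed_closure)) :
    NoseHypUnobsBTriplePrime k n H ι := by
  rw [noseHypUnobsBTriplePrime_iff_of_ambient]
  refine ⟨Z, hZ, hZreg, hunobs, hsub, hnot, hinf, hcurve, F₂, υ, hυ, F₂, 𝟙 F₂, closure (υ ⁻¹' (Set.range ι \ Z)), υ ⁻¹' Z, [], [], ∅,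
    fun R h0 _ _ _ => h0, ?_⟩
  have e : (⟨closure (closure (υ ⁻¹' (Set.range ι \ Z))), isClosed_closure⟩ : Closeds F₂) =
      ⟨closure (υ ⁻¹' (Set.range ι \ Z)), isClosed_closure⟩ := Closeds.ext closure_closure
  change Scheme.IsRegular (vanishingIdeal (⟨closure (closure (υ ⁻¹' (Set.range ι \ Z))), isClosed_closure⟩ : Closeds F₂)).subscheme
  rw [e]
  exact hreg

end Summit.ResolutionOfSingularities.ResolutionOfSingularities.Cruxes.EquisingularLiftNat.Sections

end
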